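import Literature.NumberTheory.IwasawaTheory.ClassicalMuVanishesKleinDescent
import Literature.NumberTheory.IwasawaTheory.ClassicalMuVanishesSubextension
import HarnessLib

set_option autoImplicit false

/-!
# μ-descent for a Galois group of semidihedral shape (`SD₁₆ = N_ns(3)`): a central square `z = w²` and a dihedral
# reflection `s` — `μ(L) = 0 ⟸ μ(L^{⟨s⟩}) = 0` modulo Ferrero–Washington and Iwasawa growth, BY NAME

Topic `NumberTheory/IwasawaTheory` (namespace = path).  THEOREM-ONLY file (no definition, no named fact, no `sorry`),
written by the literature seat `bsd-potss-conjA-anchor` g11 (cell `bsd-potss`; supports stmt-BirchSwinnertonDyer-19386 /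
19413; closes nothing).  It chains the kernel pieces of this seat — the Klein-four descent
(`ClassicalMuVanishesKleinDescent.lean`, [BiasseEtAl2022] Example 2.5 + Prop. 3.7 + Washington §13.1) TWICE, and the
descent to subfields of `p`-prime index (`ClassicalMuVanishesSubextension.lean`) — for a finite Galois `L/ℚ` whose group
`G` contains elements `w, s` with

  `z := w²` central of order `2`, `s² = 1`, `s ∉ {1, z}`, `s w s⁻¹ = w⁻¹`, `w ∉ {s, z s}`, `g s g⁻¹ = w³ s` for some `g`,
  and `[G, G] ⊆ ⟨w⟩`

(the non-split Cartan normaliser `N_ns(3) ≅ SD₁₆ = ⟨r, s⟩` with `w = r²`, `z = r⁴ = −1`, `g = r`: `r s r⁻¹ = r⁶ s = w³ s`,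
`s r² s⁻¹ = r⁻²`, `[SD₁₆, SD₁₆] = ⟨r²⟩`; the `D₄ = N_s(3)` rows use `classicalMuVanishes_of_isCyclotomic_of_klein_four_rat`
directly).  Road:  `μ(L) ⟸` Klein `{1, z, s, zs}` `⟸ μ(L^{⟨z⟩}), μ(L^{⟨s⟩}), μ(L^{⟨zs⟩})` (`zs = w s w⁻¹`);
`L^{⟨z⟩} =: M` is Galois over `ℚ` with group `G/⟨z⟩ ∋ w̄, s̄` commuting involutions, so `μ(M) ⟸` Klein `⟸ μ(M^{⟨w̄⟩}) = μ(L^{⟨w⟩})`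
(abelian over `ℚ` since `⟨w⟩ ⊇ [G,G]`: Ferrero–Washington) and `μ(M^{⟨s̄⟩}) = μ(L^{⟨s, z⟩})`, which follows from `μ(L^{⟨s⟩})`
(`[L^{⟨s⟩} : L^{⟨s,z⟩}] = 2`, `p` odd).  Net input: **`μ = 0` for the cyclotomic `ℤ_p`-extensions of the single field
`L^{⟨s⟩}`** (for `L = ℚ(E[3])`, `s` the involution fixing a point `P` of order `3`: `L^{⟨s⟩} = ℚ(P)`, degree `8`).

* `forall_classicalMuVanishes_of_algEquiv` — the input «`μ = 0` for every cyclotomic `ℤ_p`-extension» passes along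
  `F`-isomorphisms `E ≃ₐ[F] E'` (`p ∤ [E : F]`).
* `classicalMuVanishes_of_isCyclotomic_of_semidihedral_rat` — the statement above, under the named facts
  `iwasawa1959_classNumberPExp_growth` and `ferreroWashington1979_classicalMuVanishes` as hypotheses.

References: [BiasseEtAl2022] Example 2.5, Prop. 3.7; [Washington1997] §13.1, §10.1, §7.5; [MilneFT2022] Ch. 3;
[NeukirchANT1999] Ch. III §1 (1.6) (ii); [Lang1990] Ch. 5 §1 Thm. 1.2 (iii).
-/

noncomputable section

open scoped NumberField

open Field IntermediateField Literature.NumberTheory.GaloisRepresentations Literature.NumberTheory.EllipticCurves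
  Literature.NumberTheory.EllipticCurves.ZpExtension Literature.NumberTheory.NumberFields

namespace Literature.NumberTheory.IwasawaTheory

variable {F : Type} [Field F] [NumberField F] {p : ℕ} [Fact p.Prime]

/-! ### §1 Transport of the input along `F`-isomorphisms; fixed fields seen in a Galois quotient -/

/-- **The input «`μ = 0` for every cyclotomic `ℤ_p`-extension» passes along `E ≃ₐ[F] E'`** (`p ∤ [E : F]`; through the
restricted towers `κ|_E`, `κ|_{E'}` of the cyclotomic `κ` of `F`, `classicalMuVanishes_restrict_iff_of_algEquiv`, and the
normalisation independence `classicalMuVanishes_iff_of_isCyclotomic`). [cite: Washington1997, §13.1] -/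
theorem forall_classicalMuVanishes_of_algEquiv {E E' : Type} [Field E] [NumberField E] [Algebra F E] [Field E']
    [NumberField E'] [Algebra F E'] (φ : E ≃ₐ[F] E') (hpE : ¬ p ∣ Module.finrank F E)
    (h : ∀ κE : ZpExtension E p, κE.IsCyclotomic → ClassicalMuVanishes κE)
    (κE' : ZpExtension E' p) (hκE' : κE'.IsCyclotomic) : ClassicalMuVanishes κE' := by
  obtain ⟨κ, hκ⟩ := exists_cyclotomicZpExtension_holds F p
  have hpE' : ¬ p ∣ Module.finrank F E' := by rwa [← φ.toLinearEquiv.finrank_eq]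
  have hE := surjective_comp_absGaloisRestrict_of_not_dvd_finrank κ E hpE
  have hE' := surjective_comp_absGaloisRestrict_of_not_dvd_finrank κ E' hpE'
  have h1 : ClassicalMuVanishes (κ.restrict E hE) := h _ (isCyclotomic_restrict κ hκ E hE)
  have h2 : ClassicalMuVanishes (κ.restrict E' hE') := (classicalMuVanishes_restrict_iff_of_algEquiv κ φ hE hE').mp h1
  exact (classicalMuVanishes_iff_of_isCyclotomic _ _ (isCyclotomic_restrict κ hκ E' hE') hκE').mp h2

omit [NumberField F] in
/-- For `N ⊴ Gal(L/F)`, `N ≤ H`, and `M = L^N` (Galois over `F`): the fixed field in `M` of the image `H̄` of `H` in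
`Gal(M/F)` is `L^H` (`M^{H̄} = L^H ∩ M = L^H`; `InfiniteGalois.restrict_fixedField`).
[cite: MilneFT2022, Ch. 3 (fundamental theorem: `Gal(M/F) = G/N`, intermediate fields of `M` ↔ subgroups containing `N`)] -/
private theorem lift_fixedField_eq_of_map_restrictNormalHom {L : Type} [Field L] [Algebra F L] [FiniteDimensional F L]
    [IsGalois F L] (N H : Subgroup (L ≃ₐ[F] L)) [N.Normal] (hNH : N ≤ H)
    (H' : Subgroup (↥(fixedField N) ≃ₐ[F] ↥(fixedField N)))
    (hH' : H.map (AlgEquiv.restrictNormalHom ↥(fixedField N)) = H') :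
    IntermediateField.lift (fixedField H') = fixedField H := by
  have h1 := InfiniteGalois.restrict_fixedField H (fixedField N)
  rw [hH'] at h1
  rw [← h1]
  exact inf_eq_left.mpr (IntermediateField.fixedField_le hNH)

omit [NumberField F] in
/-- Hence `M^{H̄} ≃ₐ[F] L^H`. [cite: MilneFT2022, Ch. 3 (fundamental theorem)] -/
private theorem nonempty_algEquiv_fixedField_of_map_restrictNormalHom {L : Type} [Field L] [Algebra F L]
    [FiniteDimensional F L] [IsGalois F L] (N H : Subgroup (L ≃ₐ[F] L)) [N.Normal] (hNH : N ≤ H)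
    (H' : Subgroup (↥(fixedField N) ≃ₐ[F] ↥(fixedField N)))
    (hH' : H.map (AlgEquiv.restrictNormalHom ↥(fixedField N)) = H') :
    Nonempty (↥(fixedField H') ≃ₐ[F] ↥(fixedField H)) :=
  ⟨(IntermediateField.liftAlgEquiv (fixedField H')).trans
    (IntermediateField.equivOfEq (lift_fixedField_eq_of_map_restrictNormalHom N H hNH H' hH'))⟩

/-- The cyclic subgroup generated by an involution `t` is `{1, t}`. [folklore] -/
private theorem mem_zpowers_iff_of_mul_self {G : Type*} [Group G] {t x : G} (ht : t * t = 1) :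
    x ∈ Subgroup.zpowers t ↔ x = 1 ∨ x = t := by
  have h2 : t ^ (2 : ℤ) = 1 := by rw [zpow_two]; exact ht
  constructor
  · intro hx
    rw [Subgroup.mem_zpowers_iff] at hx
    obtain ⟨k, rfl⟩ := hx
    rcases Int.emod_two_eq_zero_or_one k with hk | hk
    · left
      rw [← Int.mul_ediv_add_emod k 2, zpow_add, zpow_mul, h2, one_zpow, one_mul, hk, zpow_zero]
    · right
      rw [← Int.mul_ediv_add_emod k 2, zpow_add, zpow_mul, h2, one_zpow, one_mul, hk, zpow_one]
  · intro hx
    rcases hx with hx | hx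
    · rw [hx]; exact one_mem _
    · rw [hx]; exact Subgroup.mem_zpowers t

omit [NumberField F] [Fact p.Prime] in
/-- `p ∤ [E : F]` for an intermediate field `E` of `L/F` when `p ∤ [L : F]`. [folklore] -/
private theorem not_dvd_finrank_intermediateField {L : Type} [Field L] [Algebra F L] [FiniteDimensional F L]
    (hp : ¬ p ∣ Module.finrank F L) (E : IntermediateField F L) : ¬ p ∣ Module.finrank F ↥E := fun h =>
  hp (h.trans (Dvd.intro _ (Module.finrank_mul_finrank F ↥E L)))

/-! ### §2 The descent -/

/-- **`μ(L) = 0 ⟸ μ(L^{⟨s⟩}) = 0` for a Galois group of `SD₁₆ = N_ns(3)` shape, by name modulo Ferrero–Washington and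
Iwasawa growth.**  `L/ℚ` finite Galois, `p` an odd prime with `p ∤ [L : ℚ]`; `w, s ∈ Gal(L/ℚ)` with `z = w²` central,
`z² = 1 ≠ z`, `s² = 1`, `s ∉ {1, z}`, `s w s⁻¹ = w⁻¹`, `w ∉ {s, z s}`, `g s g⁻¹ = w³ s` for some `g`, and `⟨w⟩ ⊇ [G, G]`.  If
`μ = 0` (growth form) holds for every cyclotomic `ℤ_p`-extension of `L^{⟨s⟩}`, then — under `iwasawa1959_classNumberPExp_growth`
and `ferreroWashington1979_classicalMuVanishes` — it holds for every cyclotomic `ℤ_p`-extension of `L`.  Road (kernel):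
Klein `{1, z, s, zs}` in `G` (`zs = w s w⁻¹`) reduces to `M = L^{⟨z⟩}`, `L^{⟨s⟩}`; Klein `{1, w̄, s̄, w̄s̄}` in `Gal(M/ℚ) = G/⟨z⟩`
reduces `μ(M)` to `L^{⟨w⟩}` (abelian: FW) and `L^{⟨s,z⟩} ⊆ L^{⟨s⟩}` (index `2`, `p` odd: `classicalMuVanishes_of_isCyclotomic_of_tower`).
For `L = ℚ(E[3])`, `Gal(L/ℚ) ≅ N_ns(3) = ⟨r, s⟩ ≅ SD₁₆`: `w = r²`, `z = −1`, `g = r`, `L^{⟨s⟩} = ℚ(P)` (degree `8`).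
[cite: BiasseEtAl2022, Example 2.5, Prop. 3.7] [cite: Washington1997, §13.1, §7.5] [cite: NeukirchANT1999, Ch. III §1 Prop. (1.6) (ii)] -/
theorem classicalMuVanishes_of_isCyclotomic_of_semidihedral_rat (hI : iwasawa1959_classNumberPExp_growth)
    (hFW : ferreroWashington1979_classicalMuVanishes) (hp2 : p ≠ 2)
    (L : Type) [Field L] [NumberField L] [IsGalois ℚ L] (hp : ¬ p ∣ Module.finrank ℚ L)
    {w s : L ≃ₐ[ℚ] L} (hzc : ∀ g : L ≃ₐ[ℚ] L, g * (w * w) = (w * w) * g) (hz4 : (w * w) * (w * w) = 1)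
    (hz1 : w * w ≠ 1) (hs : s * s = 1) (hs1 : s ≠ 1) (hsz : s ≠ w * w) (hdih : s * w * s⁻¹ = w⁻¹)
    (hws : w ≠ s) (hwzs : w ≠ w * w * s) (hconj : ∃ g : L ≃ₐ[ℚ] L, g * s * g⁻¹ = w * w * w * s)
    (hcomm : ∀ a b : L ≃ₐ[ℚ] L, a * b * a⁻¹ * b⁻¹ ∈ Subgroup.zpowers w)
    (hμs : ∀ κE : ZpExtension ↥(fixedField (Subgroup.zpowers s)) p, κE.IsCyclotomic → ClassicalMuVanishes κE)
    (κL : ZpExtension L p) (hκL : κL.IsCyclotomic) : ClassicalMuVanishes κL := by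
  obtain ⟨κ, hκ⟩ := exists_cyclotomicZpExtension_holds ℚ p
  set z : L ≃ₐ[ℚ] L := w * w with hz
  -- group-theoretic bookkeeping in `G = Gal(L/ℚ)`
  have hwinv : w⁻¹ = w * z := inv_eq_of_mul_eq_one_right (by rw [← mul_assoc, ← hz]; exact hz4)
  have hsw : s * w = w * z * s := by
    have h1 : s * w = w⁻¹ * s := by
      calc s * w = s * w * s⁻¹ * s := by group
        _ = w⁻¹ * s := by rw [hdih]
    rw [h1, hwinv]
  have hconj₁ : w * s * w⁻¹ = z * s := by
    have h1 : s * w⁻¹ * s⁻¹ = w := by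
      have := congrArg (·⁻¹) hdih
      simpa only [mul_inv_rev, inv_inv, ← mul_assoc] using this
    calc w * s * w⁻¹ = w * (s * w⁻¹ * s⁻¹) * s := by group
      _ = z * s := by rw [h1, ← hz]
  -- normal subgroups `⟨z⟩`, `⟨w⟩`
  haveI hzN : (Subgroup.zpowers z).Normal := by
    refine ⟨fun h hh a => ?_⟩
    rw [mem_zpowers_iff_of_mul_self hz4] at hh
    rcases hh with hh | hh <;> rw [hh]
    · rw [mul_one, mul_inv_cancel]; exact one_mem _
    · rw [hzc a, mul_assoc, mul_inv_cancel, mul_one]; exact Subgroup.mem_zpowers z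
  haveI hwN : (Subgroup.zpowers w).Normal := by
    refine ⟨fun h hh a => ?_⟩
    have h1 : a * h * a⁻¹ * h⁻¹ ∈ Subgroup.zpowers w := hcomm a h
    have h2 : a * h * a⁻¹ = (a * h * a⁻¹ * h⁻¹) * h := by group
    rw [h2]
    exact Subgroup.mul_mem _ h1 hh
  -- the quotient `Gal(M/ℚ)`, `M = L^{⟨z⟩}`
  set M : IntermediateField ℚ L := fixedField (Subgroup.zpowers z) with hM
  haveI : IsGalois ℚ ↥M := IsGalois.of_fixedField_normal_subgroup (Subgroup.zpowers z)
  set π : (L ≃ₐ[ℚ] L) →* (↥M ≃ₐ[ℚ] ↥M) := AlgEquiv.restrictNormalHom ↥M with hπ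
  have hker : π.ker = Subgroup.zpowers z := by
    have h1 := IntermediateField.restrictNormalHom_ker (K := ℚ) (L := L) (fixedField (Subgroup.zpowers z))
    rw [IntermediateField.fixingSubgroup_fixedField] at h1
    exact h1
  have hπker : ∀ g : L ≃ₐ[ℚ] L, π g = 1 ↔ g = 1 ∨ g = z := by
    intro g
    rw [← MonoidHom.mem_ker, hker, mem_zpowers_iff_of_mul_self hz4]
  have hπz : π z = 1 := (hπker z).mpr (Or.inr rfl)
  -- `w̄, s̄` are commuting involutions, distinct, non-trivial, with `w̄ s̄` conjugate to `s̄`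
  have hu : π w * π w = 1 := by rw [← map_mul, ← hz, hπz]
  have hv : π s * π s = 1 := by rw [← map_mul, hs, map_one]
  have huv : π w * π s = π s * π w := by
    rw [← map_mul, ← map_mul, hsw, map_mul, map_mul, map_mul, hπz, mul_one]
  have hu1 : π w ≠ 1 := by
    intro h
    rcases (hπker w).mp h with h1 | h1
    · exact hz1 (by rw [hz, h1, one_mul])
    · apply hz1
      calc z = w * w := hz
        _ = z * z := by rw [h1]
        _ = 1 := hz4
  have hv1 : π s ≠ 1 := by
    intro h
    rcases (hπker s).mp h with h1 | h1
    · exact hs1 h1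
    · exact hsz h1
  have hne : π w ≠ π s := by
    intro h
    have h1 : π (w * s⁻¹) = 1 := by rw [map_mul, map_inv, h, mul_inv_cancel]
    rcases (hπker _).mp h1 with h2 | h2
    · exact hws (by simpa using congrArg (· * s) h2)
    · exact hwzs (by simpa using congrArg (· * s) h2)
  have hconj₂ : ∃ g : ↥M ≃ₐ[ℚ] ↥M, g * π s * g⁻¹ = π w * π s := by
    obtain ⟨g, hg⟩ := hconj
    refine ⟨π g, ?_⟩
    rw [← map_inv, ← map_mul, ← map_mul, hg, map_mul, map_mul, hπz, one_mul]
  -- commutators of `Gal(M/ℚ)` lie in `⟨w̄⟩`; so `M^{⟨w̄⟩}` is abelian (it is `≅ L^{⟨w⟩}`)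
  have hπw : (Subgroup.zpowers w).map π = Subgroup.zpowers (π w) := MonoidHom.map_zpowers π w
  haveI hπwN : (Subgroup.zpowers (π w)).Normal := by
    rw [← hπw]
    exact Subgroup.Normal.map hwN π (AlgEquiv.restrictNormalHom_surjective L)
  have hcomm' : ∀ a b : ↥M ≃ₐ[ℚ] ↥M, a * b * a⁻¹ * b⁻¹ ∈ Subgroup.zpowers (π w) := by
    intro a b
    obtain ⟨a, rfl⟩ := AlgEquiv.restrictNormalHom_surjective L a
    obtain ⟨b, rfl⟩ := AlgEquiv.restrictNormalHom_surjective L b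
    have h1 : π (a * b * a⁻¹ * b⁻¹) ∈ (Subgroup.zpowers w).map π := Subgroup.mem_map_of_mem π (hcomm a b)
    rw [hπw, map_mul, map_mul, map_mul, map_inv, map_inv] at h1
    exact h1
  haveI : IsAbelianGalois ℚ ↥(fixedField (Subgroup.zpowers (π w))) :=
    isAbelianGalois_fixedField_of_commutator_mem (Subgroup.zpowers (π w)) hcomm'
  -- `M^{⟨s̄⟩} ≅ L^{⟨s, z⟩} ⊆ L^{⟨s⟩}`, of `p`-prime index
  set Hs : Subgroup (L ≃ₐ[ℚ] L) := Subgroup.zpowers s ⊔ Subgroup.zpowers z with hHs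
  have hπs : Hs.map π = Subgroup.zpowers (π s) := by
    rw [hHs, Subgroup.map_sup, MonoidHom.map_zpowers, MonoidHom.map_zpowers, hπz, Subgroup.zpowers_one_eq_bot,
      sup_bot_eq]
  obtain ⟨eS⟩ := nonempty_algEquiv_fixedField_of_map_restrictNormalHom (F := ℚ) (Subgroup.zpowers z) Hs le_sup_right
    (Subgroup.zpowers (π s)) hπs
  have hle : fixedField Hs ≤ fixedField (Subgroup.zpowers s) := IntermediateField.fixedField_le le_sup_left
  have hμHs : ∀ κK : ZpExtension ↥(fixedField Hs) p, κK.IsCyclotomic → ClassicalMuVanishes κK := by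
    letI : Algebra ↥(fixedField Hs) ↥(fixedField (Subgroup.zpowers s)) :=
      (IntermediateField.inclusion hle).toRingHom.toAlgebra
    haveI : IsScalarTower ℚ ↥(fixedField Hs) ↥(fixedField (Subgroup.zpowers s)) :=
      IsScalarTower.of_algebraMap_eq fun _ => rfl
    exact classicalMuVanishes_of_isCyclotomic_of_tower hI κ hκ ↥(fixedField Hs) ↥(fixedField (Subgroup.zpowers s))
      (not_dvd_finrank_intermediateField hp _) hμs
  have hμv : ∀ κE : ZpExtension ↥(fixedField (Subgroup.zpowers (π s))) p, κE.IsCyclotomic → ClassicalMuVanishes κE :=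
    forall_classicalMuVanishes_of_algEquiv eS.symm (not_dvd_finrank_intermediateField hp _) hμHs
  -- Step 2: `μ(M) = 0` by the Klein four `{1, w̄, s̄, w̄ s̄}` in `Gal(M/ℚ)`
  have hpM : ¬ p ∣ Module.finrank ℚ ↥M := not_dvd_finrank_intermediateField hp M
  have hμM : ∀ κM : ZpExtension ↥M p, κM.IsCyclotomic → ClassicalMuVanishes κM :=
    classicalMuVanishes_of_isCyclotomic_of_klein_four hI hp2 κ hκ ↥M hpM hu hv huv hu1 hv1 hne hconj₂
      (fun κE hκE => hFW _ p κE hκE) hμv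
  -- Step 1: `μ(L) = 0` by the Klein four `{1, z, s, z s}` in `G`
  have hzs : z * s = s * z := (hzc s).symm
  have hzs_ne : z ≠ s := fun h => hsz h.symm
  exact classicalMuVanishes_of_isCyclotomic_of_klein_four hI hp2 κ hκ L hp hz4 hs hzs hz1 hs1 hzs_ne
    ⟨w, hconj₁⟩ hμM hμs κL hκL

end Literature.NumberTheory.IwasawaTheory

end
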